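import Summits.Ventures.HodgeRepro2.HeckeEigenformsUnconditional
import Summits.Ventures.HodgeRepro2.HeckeFamilyComposition
import Summits.Ventures.HodgeRepro2.AtkinLehnerEigenvalues
import Summits.Ventures.HodgeRepro2.LevelNormalizer
import Summits.Ventures.HodgeRepro2.AntidiagonalInvolution
import Summits.Ventures.HodgeRepro2.PicardExists

/-!
# DiagonalKleinFour — the Klein four-group of coordinate sign changes of the record's Picard form `diag(1, 1, a)`
and the joint SIGN DECOMPOSITION of `S_k(Γ_N)` (p2 annex row 169)

Cell pub-hodge-repro2, Tier 5 kernel annex (seat p2, Shimura-data / Hecke side). Two definitions (`coordSign`,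
`coordSignGL`), the rest proof lane.
§8(d): uses an L-value-free non-vanishing device: NO.

For `H_a = diag(1, 1, a)` (`a ∈ K⁺`; the Picard signature / anisotropy criteria are row 168) the three coordinate
sign changes `w_i = diag(d)` with `d_j = 1` for `j = i` and `−1` otherwise (`w₁ = diag(−1,1,−1)` is row 154's
`signInvolution`) form with `1` the Klein four-group `V ⊂ SU(H_a)(K)`: involutions (`coordSignGL_mul_self`), pairwise
commuting (`coordSignGL_mul_comm`), `w₁ w₀ = w₂` (`coordSign_one_mul_zero`), `H_a`-unitary of determinant one
(`coordSignGL_mem_specialUnitaryGroup_diagonal`), stabilising every coordinate lattice (`vecMul_coordSign_mem`,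
`stabilizesLattice_coordSignGL`), hence normalising every `Γ_N` (`coordSignGL_normalizes_shimuraLevel_diagonal`,
row 153). Two normalising elements that commute have commuting Hecke operators on the Petersson space
(`heckeFamilyOf_comm_of_normalizes_both`, from row 157's composition law), so `{T_{w_i}}` is an inversion-closed
commuting family and row 135's joint eigenbasis applies:
**`exists_orthonormalBasis_coordSign_eigen`** — on the compact-quotient Petersson space of `Γ_N` of a coordinate
lattice, `S_k(Γ_N)` has an ORTHONORMAL BASIS of forms with definite signs `(ε₀, ε₁, ε₂) ∈ {±1}³`, `ε₂ = ε₀ ε₁`, under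
the three coordinate involutions (the decomposition of `S_k(Γ_N)` along the characters of `V`).

No `sorry`; `#print axioms` ⊆ {propext, Classical.choice, Quot.sound}.
-/

namespace Summit.Ventures.HodgeRepro2.ShimuraData

open Matrix

variable {K : Type*} [Field K]

/-- The coordinate sign change `w_i = diag(d)`, `d_j = 1` for `j = i`, `−1` otherwise. -/
def coordSign (i : Fin 3) : Matrix (Fin 3) (Fin 3) K :=
  Matrix.diagonal (fun j => if j = i then 1 else -1)

/-- `w_i² = 1`. -/
theorem coordSign_mul_self (i : Fin 3) : (coordSign i : Matrix (Fin 3) (Fin 3) K) * coordSign i = 1 := by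
  unfold coordSign
  rw [Matrix.diagonal_mul_diagonal]
  ext r s
  by_cases h : r = s
  · subst h; simp [Matrix.diagonal]; split_ifs <;> norm_num
  · simp [Matrix.diagonal, h]

/-- `w_i` as an element of `GL₃(K)` (its own inverse). -/
def coordSignGL (i : Fin 3) : GL (Fin 3) K :=
  ⟨coordSign i, coordSign i, coordSign_mul_self i, coordSign_mul_self i⟩

/-- The matrix of `coordSignGL i`. -/
@[simp] theorem coe_coordSignGL (i : Fin 3) : (coordSignGL i : GL (Fin 3) K).val = coordSign i := rfl

/-- `w_i * w_i = 1` in `GL₃(K)`. -/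
theorem coordSignGL_mul_self (i : Fin 3) : (coordSignGL i : GL (Fin 3) K) * coordSignGL i = 1 :=
  Units.ext (coordSign_mul_self i)

/-- Diagonal matrices commute: `w_i w_j = w_j w_i`. -/
theorem coordSignGL_mul_comm (i j : Fin 3) :
    (coordSignGL i : GL (Fin 3) K) * coordSignGL j = coordSignGL j * coordSignGL i := by
  apply Units.ext
  simp only [Units.val_mul, coe_coordSignGL, coordSign, Matrix.diagonal_mul_diagonal, mul_comm]

/-- `w₁ = diag(−1, 1, −1)` is row 154's sign involution. -/
theorem coordSign_one_eq_signInvolution : (coordSign 1 : Matrix (Fin 3) (Fin 3) K) = signInvolution := by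
  ext r s
  fin_cases r <;> fin_cases s <;> simp [coordSign, signInvolution, Matrix.diagonal]

/-- `w₁ w₀ = w₂`. -/
theorem coordSign_one_mul_zero : (coordSign 1 : Matrix (Fin 3) (Fin 3) K) * coordSign 0 = coordSign 2 := by
  unfold coordSign
  rw [Matrix.diagonal_mul_diagonal]
  ext r s
  fin_cases r <;> fin_cases s <;> simp [Matrix.diagonal]

/-- `w₁ w₀ = w₂` in `GL₃(K)`. -/
theorem coordSignGL_one_mul_zero : (coordSignGL 1 : GL (Fin 3) K) * coordSignGL 0 = coordSignGL 2 :=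
  Units.ext coordSign_one_mul_zero

/-- A coordinate lattice is stable under `w_i` (row action `x ↦ x w_i`: coordinatewise signs). -/
theorem vecMul_coordSign_mem {𝔪 : Submodule ℤ (Fin 3 → K)}
    (hcoord : ∀ x ∈ 𝔪, ∀ i : Fin 3, Pi.single i (x i) ∈ 𝔪) (i : Fin 3) {x : Fin 3 → K} (hx : x ∈ 𝔪) :
    Matrix.vecMul x (coordSign i) ∈ 𝔪 := by
  have h : Matrix.vecMul x (coordSign i) =
      ∑ j : Fin 3, Pi.single j (x j * (if j = i then 1 else -1)) := by
    ext j
    rw [Finset.sum_apply]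
    simp only [coordSign, Matrix.vecMul_diagonal, Pi.single_apply, Finset.sum_ite_eq, Finset.mem_univ,
      if_true]
  rw [h]
  refine Submodule.sum_mem _ (fun j _ => ?_)
  split_ifs
  · simpa using hcoord x hx j
  · rw [mul_neg, mul_one, Pi.single_neg]
    exact Submodule.neg_mem _ (hcoord x hx j)

/-- `w_i` stabilises every coordinate lattice (row 153's `StabilizesLattice`). -/
theorem stabilizesLattice_coordSignGL {𝔪 : Submodule ℤ (Fin 3 → K)}
    (hcoord : ∀ x ∈ 𝔪, ∀ i : Fin 3, Pi.single i (x i) ∈ 𝔪) (i : Fin 3) :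
    StabilizesLattice 𝔪 (coordSignGL i) :=
  StabilizesLattice.of_sq_eq_one (coordSignGL_mul_self i) (fun _ hx => vecMul_coordSign_mem hcoord i hx)

variable [NumberField K] [NumberField.IsCMField K]

/-- `w_i ∈ U(H_a)(K)` for `H_a = diag(1, 1, a)`. -/
theorem coordSignGL_mem_unitaryGroup_diagonal (a : NumberField.maximalRealSubfield K) (i : Fin 3) :
    (coordSignGL i : GL (Fin 3) K) ∈
      unitaryGroup K (Matrix.diagonal ![1, 1, (algebraMap (NumberField.maximalRealSubfield K) K) a]) := by
  show conjTransposeK K (coordSignGL i : GL (Fin 3) K).val * _ * (coordSignGL i : GL (Fin 3) K).val = _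
  rw [coe_coordSignGL]
  ext r s
  fin_cases i <;> fin_cases r <;> fin_cases s <;>
    simp [conjTransposeK, coordSign, Matrix.mul_apply, Matrix.diagonal, Matrix.transpose_apply,
      Matrix.map_apply]

/-- `w_i ∈ SU(H_a)(K)`. -/
theorem coordSignGL_mem_specialUnitaryGroup_diagonal (a : NumberField.maximalRealSubfield K) (i : Fin 3) :
    (coordSignGL i : GL (Fin 3) K) ∈
      specialUnitaryGroup K (Matrix.diagonal ![1, 1, (algebraMap (NumberField.maximalRealSubfield K) K) a]) := by
  refine Subgroup.mem_inf.mpr ⟨coordSignGL_mem_unitaryGroup_diagonal a i, ?_⟩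
  rw [MonoidHom.mem_ker]
  ext
  fin_cases i <;> simp [coe_coordSignGL, coordSign, Matrix.det_diagonal, Fin.prod_univ_three]

/-- `w_i` normalises every `Γ_N` of `H_a` and a coordinate lattice (row 153). -/
theorem coordSignGL_normalizes_shimuraLevel_diagonal (a : NumberField.maximalRealSubfield K)
    {𝔪 : Submodule ℤ (Fin 3 → K)} (hcoord : ∀ x ∈ 𝔪, ∀ i : Fin 3, Pi.single i (x i) ∈ 𝔪) (i : Fin 3) (N : ℕ)
    (s : GL (Fin 3) K) :
    s ∈ shimuraLevelSubgroup K (Matrix.diagonal ![1, 1, (algebraMap (NumberField.maximalRealSubfield K) K) a])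
        𝔪 N ↔
      (coordSignGL i : GL (Fin 3) K) * s * (coordSignGL i)⁻¹ ∈
        shimuraLevelSubgroup K (Matrix.diagonal ![1, 1, (algebraMap (NumberField.maximalRealSubfield K) K) a])
          𝔪 N :=
  mem_shimuraLevel_conj_iff (coordSignGL_mem_unitaryGroup_diagonal a i) (stabilizesLattice_coordSignGL hcoord i) s

section PeterssonSpace

variable {τ₁ : K →+* ℂ} {H : Matrix (Fin 3) (Fin 3) K} {Q : Matrix (Fin 3) (Fin 3) ℂ}
  (hQ : IsFrame K τ₁ H Q) (S : Subgroup (GL (Fin 3) K)) (hS : (S : Set (GL (Fin 3) K)) ⊆ unitaryGroup K H)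
  [CompactSpace (ballQuotient hQ S hS)] {D : Set ball₂} (k : ℕ) (hD : IsBallFundamentalDomain hQ S hS D)
  (hDm : MeasurableSet D)
  (inst : ∀ δ : unitaryGroup K H, Fintype (S ⧸ (heckeSubgroup S (δ : GL (Fin 3) K)).subgroupOf S))

/-- Two elements of `U(H)(K)` that both normalise `S` and commute have commuting Hecke operators on the Petersson
space (`T_α T_β = T_{βα} = T_{αβ} = T_β T_α`, row 157). -/
theorem heckeFamilyOf_comm_of_normalizes_both {β α : unitaryGroup K H}
    (hβ : ∀ s : GL (Fin 3) K, s ∈ S ↔ (β : GL (Fin 3) K) * s * (β : GL (Fin 3) K)⁻¹ ∈ S)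
    (hα : ∀ s : GL (Fin 3) K, s ∈ S ↔ (α : GL (Fin 3) K) * s * (α : GL (Fin 3) K)⁻¹ ∈ S)
    (hc : β * α = α * β) (v : PeterssonSpace hQ S hS k hD) :
    heckeFamilyOf hQ S hS k hD hDm inst α (heckeFamilyOf hQ S hS k hD hDm inst β v) =
      heckeFamilyOf hQ S hS k hD hDm inst β (heckeFamilyOf hQ S hS k hD hDm inst α v) := by
  rw [heckeFamilyOf_heckeFamilyOf_eq_of_normalizes hQ S hS k hD hDm inst hβ v,
    heckeFamilyOf_heckeFamilyOf_eq_of_normalizes hQ S hS k hD hDm inst hα v, hc]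

end PeterssonSpace

section KleinFour

variable {τ₁ : K →+* ℂ} {a : NumberField.maximalRealSubfield K} {Q : Matrix (Fin 3) (Fin 3) ℂ}
  (hQ : IsFrame K τ₁ (Matrix.diagonal ![1, 1, (algebraMap (NumberField.maximalRealSubfield K) K) a]) Q)
  {𝔪 : Submodule ℤ (Fin 3 → K)} (h𝔪 : IsLattice K 𝔪)
  (hcoord : ∀ x ∈ 𝔪, ∀ i : Fin 3, Pi.single i (x i) ∈ 𝔪) {N : ℕ} (hN : N ≠ 0)
  [CompactSpace (ballQuotient hQ
    (shimuraLevelSubgroup K (Matrix.diagonal ![1, 1, (algebraMap (NumberField.maximalRealSubfield K) K) a]) 𝔪 N)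
    (shimuraLevelSubgroup_subset_unitaryGroup
      (Matrix.diagonal ![1, 1, (algebraMap (NumberField.maximalRealSubfield K) K) a]) 𝔪 N))]
  {D : Set ball₂} (k : ℕ)
  (hD : IsBallFundamentalDomain hQ
    (shimuraLevelSubgroup K (Matrix.diagonal ![1, 1, (algebraMap (NumberField.maximalRealSubfield K) K) a]) 𝔪 N)
    (shimuraLevelSubgroup_subset_unitaryGroup
      (Matrix.diagonal ![1, 1, (algebraMap (NumberField.maximalRealSubfield K) K) a]) 𝔪 N) D)
  (hDm : MeasurableSet D)

/-- The coordinate sign changes as elements of `U(H_a)(K)`. -/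
def coordSignU (a : NumberField.maximalRealSubfield K) (i : Fin 3) :
    unitaryGroup K (Matrix.diagonal ![1, 1, (algebraMap (NumberField.maximalRealSubfield K) K) a]) :=
  ⟨coordSignGL i, coordSignGL_mem_unitaryGroup_diagonal a i⟩

include hQ hcoord hD hDm in
/-- The Hecke operators of the coordinate sign changes commute on the Petersson space of `Γ_N`. -/
theorem commute_heckeFamilyOf_coordSignU
    (inst : ∀ δ : unitaryGroup K
      (Matrix.diagonal ![1, 1, (algebraMap (NumberField.maximalRealSubfield K) K) a]),
      Fintype (shimuraLevelSubgroup K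
        (Matrix.diagonal ![1, 1, (algebraMap (NumberField.maximalRealSubfield K) K) a]) 𝔪 N ⧸
        (heckeSubgroup (shimuraLevelSubgroup K
          (Matrix.diagonal ![1, 1, (algebraMap (NumberField.maximalRealSubfield K) K) a]) 𝔪 N)
          (δ : GL (Fin 3) K)).subgroupOf (shimuraLevelSubgroup K
          (Matrix.diagonal ![1, 1, (algebraMap (NumberField.maximalRealSubfield K) K) a]) 𝔪 N)))
    (i j : Fin 3) :
    Commute (heckeFamilyOf hQ _ _ k hD hDm inst (coordSignU a i))
      (heckeFamilyOf hQ _ _ k hD hDm inst (coordSignU a j)) := by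
  have hnorm : ∀ i : Fin 3, ∀ s : GL (Fin 3) K,
      s ∈ shimuraLevelSubgroup K (Matrix.diagonal ![1, 1, (algebraMap (NumberField.maximalRealSubfield K) K) a])
        𝔪 N ↔ (coordSignU a i : GL (Fin 3) K) * s * (coordSignU a i : GL (Fin 3) K)⁻¹ ∈
        shimuraLevelSubgroup K (Matrix.diagonal ![1, 1, (algebraMap (NumberField.maximalRealSubfield K) K) a])
          𝔪 N :=
    fun i => coordSignGL_normalizes_shimuraLevel_diagonal a hcoord i N
  have hc : coordSignU a j * coordSignU a i = coordSignU a i * coordSignU a j :=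
    Subtype.ext (coordSignGL_mul_comm j i)
  refine LinearMap.ext (fun v => ?_)
  rw [Module.End.mul_apply, Module.End.mul_apply]
  exact heckeFamilyOf_comm_of_normalizes_both hQ _ _ k hD hDm inst (hnorm j) (hnorm i) hc v

include hQ hcoord hD hDm in
/-- From a joint eigenvector of the three coordinate involutions to its SIGNS `(ε₀, ε₁, ε₂) ∈ {±1}³`,
`ε₂ = ε₀ ε₁` (row 148 and `w₁ w₀ = w₂`). -/
theorem exists_signs_of_joint_eigen
    (inst : ∀ δ : unitaryGroup K
      (Matrix.diagonal ![1, 1, (algebraMap (NumberField.maximalRealSubfield K) K) a]),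
      Fintype (shimuraLevelSubgroup K
        (Matrix.diagonal ![1, 1, (algebraMap (NumberField.maximalRealSubfield K) K) a]) 𝔪 N ⧸
        (heckeSubgroup (shimuraLevelSubgroup K
          (Matrix.diagonal ![1, 1, (algebraMap (NumberField.maximalRealSubfield K) K) a]) 𝔪 N)
          (δ : GL (Fin 3) K)).subgroupOf (shimuraLevelSubgroup K
          (Matrix.diagonal ![1, 1, (algebraMap (NumberField.maximalRealSubfield K) K) a]) 𝔪 N)))
    {v : PeterssonSpace hQ _ _ k hD} (hv : v ≠ 0)
    (hb : ∀ i : Fin 3, ∃ μ : ℂ, heckeFamilyOf hQ _ _ k hD hDm inst (coordSignU a i) v = μ • v) :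
    ∃ ε : Fin 3 → ℂ, (∀ i, ε i = 1 ∨ ε i = -1) ∧ ε 2 = ε 0 * ε 1 ∧
      ∀ i, heckeFamilyOf hQ _ _ k hD hDm inst (coordSignU a i) v = ε i • v := by
  choose ε hε using hb
  have hnorm : ∀ i : Fin 3, ∀ s : GL (Fin 3) K,
      s ∈ shimuraLevelSubgroup K (Matrix.diagonal ![1, 1, (algebraMap (NumberField.maximalRealSubfield K) K) a])
        𝔪 N ↔ (coordSignU a i : GL (Fin 3) K) * s * (coordSignU a i : GL (Fin 3) K)⁻¹ ∈
        shimuraLevelSubgroup K (Matrix.diagonal ![1, 1, (algebraMap (NumberField.maximalRealSubfield K) K) a])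
          𝔪 N :=
    fun i => coordSignGL_normalizes_shimuraLevel_diagonal a hcoord i N
  have hsq : ∀ i : Fin 3, (coordSignU a i : GL (Fin 3) K) * coordSignU a i = 1 := fun i =>
    coordSignGL_mul_self i
  have hpm : ∀ i, ε i = 1 ∨ ε i = -1 := fun i =>
    heckeFamilyOf_eigenvalue_eq_one_or_neg_one_of_normalizes_of_sq_eq_one hQ _ _ k hD hDm inst (hnorm i)
      (hsq i) hv (hε i)
  refine ⟨ε, hpm, ?_, hε⟩
  -- `T_{w₂} = T_{w₁ w₀} = T_{w₀} ∘ T_{w₁}` on the joint eigenvector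
  have h2 : heckeFamilyOf hQ _ _ k hD hDm inst (coordSignU a 2) v =
      heckeFamilyOf hQ _ _ k hD hDm inst (coordSignU a 0)
        (heckeFamilyOf hQ _ _ k hD hDm inst (coordSignU a 1) v) := by
    rw [heckeFamilyOf_heckeFamilyOf_eq_of_normalizes hQ _ _ k hD hDm inst (hnorm 1)]
    congr 2
    exact Subtype.ext coordSignGL_one_mul_zero.symm
  rw [hε 2, hε 1, map_smul, hε 0, smul_smul] at h2
  have h3 : (ε 2 - ε 0 * ε 1) • v = 0 := by
    rw [sub_smul, h2, mul_comm, sub_self]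
  rcases smul_eq_zero.mp h3 with h | h
  · exact sub_eq_zero.mp h
  · exact absurd h hv

include hQ h𝔪 hcoord hN hD hDm in
/-- THE SIGN DECOMPOSITION OF `S_k(Γ_N)`: for the record's Picard form `H_a` (definite at every place other than
`τ₁`), `Γ_N` of a coordinate lattice with compact quotient, the space of holomorphic weight-`k` forms has an
orthonormal basis of forms with definite signs `(ε₀, ε₁, ε₂) ∈ {±1}³`, `ε₂ = ε₀ ε₁`, under the three coordinate
involutions `w₀, w₁, w₂` (row 135's joint eigenbasis for the inversion-closed commuting family `{T_{w_i}}`, row 148's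
`±1`, and `w₁ w₀ = w₂`). -/
theorem exists_orthonormalBasis_coordSign_eigen
    (hdef : ∀ τ : K →+* ℂ, NumberField.InfinitePlace.mk τ ≠ NumberField.InfinitePlace.mk τ₁ →
      IsDefiniteAt K τ (Matrix.diagonal ![1, 1, (algebraMap (NumberField.maximalRealSubfield K) K) a])) :
    ∃ b : OrthonormalBasis (Fin (Module.finrank ℂ (holomorphicSpace hQ _ _ k hD))) ℂ (holomorphicSpace hQ _ _ k hD),
      ∀ x, ∃ ε : Fin 3 → ℂ, (∀ i, ε i = 1 ∨ ε i = -1) ∧ ε 2 = ε 0 * ε 1 ∧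
        ∀ i, heckeFamilyOf hQ _ _ k hD hDm
          (fun δ => fintypeHeckeQuotientOfFiniteIndex h𝔪 (shimuraLevelSubgroup_le_one _ _ _)
            (finiteIndex_subgroupOf_shimuraLevel _ _ h𝔪 hN) δ.2) (coordSignU a i) (b x) = ε i • (b x) := by
  have hinv : ∀ i : Fin 3, coordSignU a i = (coordSignU a i)⁻¹ := fun i =>
    (inv_eq_of_mul_eq_one_right (Subtype.ext (coordSignGL_mul_self i))).symm
  obtain ⟨b, hb⟩ := exists_orthonormalBasis_heckeSpace_holomorphic_unconditional
    (isHermitianForm_diagonal_one_one K a) hdef hQ h𝔪 (subset_refl _) (shimuraLevelSubgroup_le_one _ _ _)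
    (finiteIndex_subgroupOf_shimuraLevel _ _ h𝔪 hN) k hD hDm (coordSignU a) id hinv
    (commute_heckeFamilyOf_coordSignU hQ hcoord k hD hDm _)
  refine ⟨b, fun x => ?_⟩
  have hbx : (b x : PeterssonSpace hQ _ _ k hD) ≠ 0 := fun h0 =>
    b.orthonormal.ne_zero x (Subtype.ext h0)
  exact exists_signs_of_joint_eigen hQ hcoord k hD hDm _ hbx (hb x)

end KleinFour

end Summit.Ventures.HodgeRepro2.ShimuraData
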